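import Summits.QuantumAdvantage.QuantumAdvantage.Theses.CubicForrelation
import Literature.Computability.QuantumComplexity.ForrelationDerivativeTables
import Literature.Computability.QuantumComplexity.SignedCubicForrelation
import HarnessLib

/-!
# Disproof work file — crux r3 `SignedExactCubicForrelationNotPrBPP` (stmt-QuantumAdvantage-13932)

Standing disprover `refuter-cdisprove-stmt-QuantumAdvantage-13932-0`, cycle 1 (2026-08-16).
Crux (route `QuantumAdvantage/CubicForrelation`, rank 3): the SIGNED EXACT slice of cubic 2-fold
Forrelation — yes `Φ = 1` (b cubic bent with cubic dual `b̃ = a`), no `Φ = -1` (`a = b̃ ⊕ 1`), `n` even,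
`B₂`-circuits — is not in `PromiseBPP'`. Deciding it = one bit `c = a(0) ⊕ b̃(0)` = the sign of the
Walsh sum `∑_y (-1)^{b(y)} = ± 2^{n/2}`.

## Findings (index; prose only in docstrings, everything below `sorry`-free unless marked NEAR-MISS)

(a) **SIGN TRANSPORT (Poisson summation for exact pairs)** — PROVED (`sign_transport`,
    `coset_sum_eq_of_forrelation_eq_one`, `coset_sum_eq_of_forrelation_eq_neg_one`, `sign_rule_yes`,
    `sign_rule_no`, `exists_twist_sum_ne_zero`) and LANDED in the tree as
    `Literature/Computability/QuantumComplexity/ForrelationSignTransport.lean` (p72523, ACCEPTED,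
    commit b0abac952819; namespace `Literature.Computability.QuantumComplexity.DerivativeWalsh`).
    For `Φ(a,b) = ε ∈ {±1}`, EVERY subspace `U ≤ 𝔽₂ⁿ` and every shift `r`:
        `|U| · ∑_{y ∈ r + U^⊥} (-1)^{b(y)} = ε · 2^{n/2} · ∑_{x ∈ U} (-1)^{a(x) + r·x}`,          (★)
    and some `r` makes the right-hand sum non-zero (Parseval on `U`). So the crux bit is
        `ε = sgn(∑_{y∈r+U^⊥}(-1)^{b}) · sgn(∑_{x∈U}(-1)^{a + r·x})`      for ANY `U` and any good `r`.
    Consequence (the load-bearing reduction, on paper): call `U` **bi-isotropic** for the cubic pair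
    `(a,b)` when the cubic part of `a` vanishes on `U` (all third differences of `a` along `U` are 0,
    i.e. `a` is quadratic on every coset of `U`) and the cubic part of `b` vanishes on `U^⊥`. Then BOTH
    sums in (★) are quadratic Gauss sums over `𝔽₂` — exact, signed, polynomial time by variable
    elimination (Dickson) — and a good `r` is found by linear algebra (Walsh support of the quadratic
    `a|_U` = a coset of `rad^⊥`). Hence
        **SignedExact ≤ᴾ BI-ISO := "given the two cubic coefficient tensors (T_a, T_b), output a
        bi-isotropic subspace".**
    This refutes two sentences of the route text as stated: "every odd polarisation of `Φ` keeps an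
    intractable cubic sum" (★ is first-order in `b` and has none, once `U` is known) and "the sign is a
    cubic Arf invariant, `#P`-hard to evaluate" (the `#P`-hardness of `∑(-1)^{b}` for GENERAL cubic `b`
    is irrelevant on the promise: the bent/dual promise hands over `a`, and (★) trades the cubic sum for
    two quadratic ones). ALL hardness of the crux, if any, is the hardness of BI-ISO on the promise set.

(a') **M-SUBSPACE DUALITY** — PROVED (`dual_affine_on_perp_cosets`, with `sum_char_subspace`,
    `card_mul_card_perp`, `perp_perp_eq_of_sq`, `coset_sum_of_affine_on_cosets`,
    `all_eq_of_sum_eq_card`); Literature twin `ForrelationMSubspaceDuality.lean` proposed. If `b` is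
    affine on the cosets of a subspace `V` with `|V|² = 2ⁿ` (an M-subspace: all second differences along
    `V` vanish; Dillon's criterion for the completed MM class [cite: Carlet2020, Prop. 54]) and
    `Φ(a,b) = ±1`, then `a` is affine on EVERY coset of `V^⊥` — McFarland's dual formula
    [cite: Carlet2020, Prop. 77], here for ALL exact pairs. Hence (M-subspace of `b`, however found) ⇒
    bi-affine pair `(V, V^⊥)` ⇒ the sign by (★) from two sums of AFFINE `±1`-functions: the sign step of
    every M-subspace attack (this seat's `biiso.py`, the r-attack seat's `msub_attack.py`) is a theorem.

(b) **BI-ISO is easy on every Maiorana–McFarland family proposed so far** (kit evidence, this seat's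
    `biiso.py`, pure python; job ids in `## Evidence` below and on the item). For an MM pair
    `b = y'·π(y'') + h(y'')`, `b̃ = x''·π⁻¹(x') + h(π⁻¹(x'))` (any quadratic permutation `π` with
    quadratic inverse, any admissible cubic `h`, any affine disguise with the dual twist) EVERY
    M-subspace `V` of `b` (`dim V = n/2`, `D_u D_v b ≡ 0` on `V`) is bi-isotropic with `U = V^⊥`
    (`b` affine on cosets of `V`, `a` affine on cosets of `V^⊥`: MM duality), and M-subspaces are
    recovered by LINEAR ALGEBRA on `T_b` plus `O(n²)` evaluations of `b`:
      * kernel spaces `R_w = ker T_b(w,·,·)` meet the hidden `V` in dimension ≥ the differential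
        corank `κ(w'') ≥ 1` of `π` (permutation ⇒ every component `v'·π` is balanced ⇒ degenerate);
      * `E`-closure: `E(S) = {u : T_b(u,S,·) = 0, D_uD_s b(0) = 0 ∀ s ∈ S}` is a subspace computable by
        linear algebra (on `∩_s R_s` the maps `u ↦ D_uD_s b(0)` are linear) and `E(S) ⊇ V` whenever
        `S ⊆ V`; two generic true seeds already give `E(S) = V`;
      * seeds: minimal-rank points of `u ↦ rank T_b(u,·,·)` inside small intersections `R_w ∩ R_w'`
        (for block-APN `π`, e.g. the route's `𝔽₈`-cube family, the rank-2 points are EXACTLY the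
        single-block vectors of `V`), whole intersections `R_w∩R_w'∩R_w''`, radicals `Rad T_b`,
        `(Rad T_a)^⊥` (which alone solve every Feistel-type / linear-structure-rich `π`).
    Outcome table (local run + kit): families cube (`𝔽₈`-cube blocks = the route's designated hard
    family), cube+identity, balanced / thin / fat Feistel involutions `(s + Q(t), t)`, mixed, and
    linear-structure-rich `h`: sign correct on every solved instance, NO wrong sign ever (the sign step is
    a theorem), `n = 8 … 64`; unsolved residue only from finder time-outs on some cube+LS mixtures at
    `n ≥ 48` in pure python (see the job logs for exact counts). Independent confirmation: the r-attack
    seat's `msub_attack.py` (kit j007388) recovers M-subspaces of the `𝔽₈`-cube family 40/40, `n ≤ 96`.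

(c) **Why the crux nevertheless RESISTS a formal kill (honest status).**
    1. `¬S` needs `signedExactCubicForrelationProblem 2 ∈ PromiseBPP'`, i.e. a WORST-CASE polynomial
       -time decider on ALL exact cubic pairs + an `FP`/`TM2` witness (`mem_PromiseBPP'_of_fp_decider`).
       Even the unsigned rung (crux 2204, five on-paper derivations) is not landed for want of that
       plumbing.  2. Worst case over MM pairs = a MinRank/`IP1S`-type search ("half-dimensional common
       isotropic subspace of the alternating pencil `T_b(·,·,w)` with a planted solution"); every
       instance family tried is easy, no proof of uniform easiness (the finder is a heuristic zoo with a
       sound certificate).  3. Non-MM exact cubic pairs (`¬ExactPairsMaioranaMcFarland`, r5 open): (★)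
       still applies but the EXISTENCE of a bi-isotropic `U` is then unknown.
    So: S is separation-barred from above (S ⇒ PromiseBQP ⊄ PromiseBPP', barrier
    `SeparationPrerequisites`) and practically dead from below (no planted family stands); its truth
    value hinges on "∃ exact cubic pairs whose bi-isotropic subspaces are hard to find" — an
    `IP1S`/MinRank-type cryptographic assumption on a very thin, very structured key space.

(d) Load-bearing hypotheses of S ("drop H and it breaks"): S has no hypotheses; its promise conditions:
    `Even n` — inert (odd `n` has no bent functions: both sides empty there); `deg ≤ 3` — dropping it only
    enlarges the problem (S gets weaker, not refutable this way); exactness `Φ = ±1` — weakening to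
    `±3/5` is the target X (weaker). The informative MUTATIONS are strengthenings of S, all refuted on
    paper by (a)+(b): S⁺¹ "hard even given an M-subspace as advice" (false: (★)), S⁺² "hard on the
    `𝔽₈`-cube family" (false: (b), and j007388), S⁺³ "hard on Feistel/LS-rich templates" (false:
    radicals), S⁺⁴ "the unsigned exact slice is hard" (false: crux 2203, `dwt_transpose_…`).

(e) NEAR-MISS (sorried, this file only): `crux_false_sketch`.

## Evidence / reproducibility
* `biiso.py` (this folder; attached to the item): generator of disguised MM cubic bent/dual pairs
  (self-tests: brute-force duality `W_b = 2^{n/2}(-1)^{a+c}` for `n ≤ 12`; third differences of the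
  black boxes = transported tensors), finder, sign by (★); env `JOB_NS`, `JOB_TRIALS`, `JOB_FAMS`.
* kit jobs: see NOTES.md / item evidence notes (ids recorded there when the queue returns them).

## References
AaronsonAmbainis2018 §3.2 Prop. 6 (one-query sign test); Dillon 1974 / McFarland 1973 (MM class and
its dual); Carlet 2021 §6.1 (duals, second-order derivatives, M-subspaces); Kipnis–Shamir 1998/1999
(oil-and-vinegar / MinRank kernel attacks); Polujan–Pott 2020 (M-subspace algorithmics, cubic bent
functions outside MM#); tree: `ForrelationDerivativeTables.lean` (Φ² lever, sign-blind),
`SignedCubicForrelation.lean` (vocabulary of the signed slices).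
-/

noncomputable section

namespace Summit.QuantumAdvantage.QuantumAdvantage.Cruxes.SignedExactCubicForrelationNotPrBPP.Disproof

open Finset
open Literature.Computability.QuantumComplexity
open Literature.Computability.QuantumComplexity.BuzetChailloux
open Literature.Computability.QuantumComplexity.Simon
open Literature.Computability.QuantumComplexity.DerivativeWalsh

variable {n : ℕ}

/-! ### Subspaces of `𝔽₂ⁿ` as finsets, orthogonals, character sums -/

/-- A linear subspace of `𝔽₂ⁿ`, presented as a finset of bit vectors containing `0` and closed under `⊕`.
[folklore] -/
def IsSubspace (U : Finset (Fin n → Bool)) : Prop :=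
  zeroVec ∈ U ∧ ∀ x ∈ U, ∀ y ∈ U, bxor x y ∈ U

/-- The orthogonal `U^⊥ = {y : (-1)^{x·y} = 1 for all x ∈ U}`. [folklore] -/
def perp (U : Finset (Fin n → Bool)) : Finset (Fin n → Bool) :=
  univ.filter fun y => ∀ x ∈ U, twist x y = 1

theorem mem_perp {U : Finset (Fin n → Bool)} {y : Fin n → Bool} :
    y ∈ perp U ↔ ∀ x ∈ U, twist x y = 1 := by
  simp [perp]

/-- `(-1)^{(a ⊕ b)·y} = (-1)^{a·y} (-1)^{b·y}`. [folklore] -/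
theorem twist_bxor_left (a b y : Fin n → Bool) : twist (bxor a b) y = twist a y * twist b y := by
  rw [twist_comm, twist_bxor_right, twist_comm y a, twist_comm y b]

/-- **Character sum over a subspace**: `∑_{x ∈ U} (-1)^{x·y} = |U| · [y ∈ U^⊥]`. [folklore] -/
theorem sum_twist_subspace {U : Finset (Fin n → Bool)} (hU : IsSubspace U) (y : Fin n → Bool) :
    ∑ x ∈ U, twist x y = if y ∈ perp U then (U.card : ℝ) else 0 := by
  split_ifs with hy
  · rw [sum_congr rfl (mem_perp.1 hy), sum_const, nsmul_eq_mul, mul_one]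
  · obtain ⟨x₀, hx₀, hne⟩ : ∃ x₀ ∈ U, twist x₀ y ≠ 1 := by
      by_contra h
      push Not at h
      exact hy (mem_perp.2 h)
    have hneg : twist x₀ y = -1 := (twist_eq_one_or x₀ y).resolve_left hne
    have key : ∑ x ∈ U, twist (bxor x₀ x) y = ∑ x ∈ U, twist x y :=
      Finset.sum_nbij' (fun x => bxor x₀ x) (fun x => bxor x₀ x)
        (fun a ha => hU.2 x₀ hx₀ a ha) (fun a ha => hU.2 x₀ hx₀ a ha)
        (fun a _ => bxor_bxor_cancel_left x₀ a) (fun a _ => bxor_bxor_cancel_left x₀ a)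
        (fun a _ => rfl)
    have h2 : ∑ x ∈ U, twist (bxor x₀ x) y = twist x₀ y * ∑ x ∈ U, twist x y := by
      rw [mul_sum]
      exact sum_congr rfl fun x _ => twist_bxor_left x₀ x y
    have h3 := key.symm.trans h2
    rw [hneg] at h3
    linarith

/-- **Poisson summation over a coset of `U^⊥`** (any real `g`):
`|U| · ∑_{y ∈ r + U^⊥} g(y) = ∑_{x ∈ U} (-1)^{x·r} W_g(x)`. [folklore] -/
theorem card_mul_sum_coset {U : Finset (Fin n → Bool)} (hU : IsSubspace U)
    (g : (Fin n → Bool) → ℝ) (r : Fin n → Bool) :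
    (U.card : ℝ) * ∑ y ∈ univ.filter (fun y => bxor r y ∈ perp U), g y =
      ∑ x ∈ U, twist x r * W g x := by
  have h1 : ∀ x ∈ U, twist x r * W g x = ∑ y, g y * twist x (bxor r y) := by
    intro x _
    rw [W, mul_sum]
    refine sum_congr rfl fun y _ => ?_
    rw [twist_bxor_right, twist_comm y x]
    ring
  rw [sum_congr rfl h1, sum_comm]
  have h2 : ∀ y : Fin n → Bool, ∑ x ∈ U, g y * twist x (bxor r y) =
      if bxor r y ∈ perp U then (U.card : ℝ) * g y else 0 := by
    intro y
    rw [← mul_sum, sum_twist_subspace hU]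
    split_ifs <;> ring
  rw [sum_congr rfl fun y _ => h2 y, ← sum_filter, mul_sum]

/-! ### Parseval for `W` and the pointwise duality from `Φ² = 1` -/

/-- Parseval: `∑_x W_g(x)² = 2ⁿ ∑_y g(y)²`. [cite: ODonnell2014, §1.4] -/
theorem sum_W_sq (g : (Fin n → Bool) → ℝ) : ∑ x, W g x ^ 2 = (2 : ℝ) ^ n * ∑ y, g y ^ 2 := by
  have e1 : ∀ x : Fin n → Bool, W g x ^ 2 = ∑ y, ∑ y', g y * g y' * twist (bxor y y') x := by
    intro x
    rw [W, sq, sum_mul_sum]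
    refine sum_congr rfl fun y _ => sum_congr rfl fun y' _ => ?_
    rw [twist_bxor_left]
    ring
  rw [sum_congr rfl fun x _ => e1 x, sum_comm]
  have e2 : ∀ y : Fin n → Bool,
      ∑ x, ∑ y', g y * g y' * twist (bxor y y') x = (2 : ℝ) ^ n * g y ^ 2 := by
    intro y
    rw [sum_comm]
    have e3 : ∀ y' : Fin n → Bool, ∑ x, g y * g y' * twist (bxor y y') x =
        g y * g y' * (if bxor y y' = zeroVec then (2 : ℝ) ^ n else 0) := by
      intro y'
      rw [← mul_sum]
      congr 1
      simp_rw [twist_comm (bxor y y')]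
      exact sum_twist_left _
    rw [sum_congr rfl fun y' _ => e3 y']
    simp_rw [bxor_eq_zeroVec_iff, mul_ite, mul_zero]
    rw [Finset.sum_ite_eq univ y, if_pos (mem_univ _)]
    ring
  rw [sum_congr rfl fun y _ => e2 y, ← mul_sum]

/-- **Exact duality, pointwise**: for `±1`-valued `f, g` with `S(f,g)² = 8ⁿ` (i.e. `Φ(f,g) = ±1`),
`2ⁿ · W_g(x) = S(f,g) · f(x)` for EVERY `x` — `g` is bent and its dual sign pattern is `± f`
(Cauchy–Schwarz equality case, via `∑_x (2ⁿ W_g(x) - S f(x))² = 0`).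
[cite: AaronsonAmbainis2018, §1.1.1] -/
theorem two_pow_mul_W_eq (f g : (Fin n → Bool) → ℝ) (hf : ∀ x, f x ^ 2 = 1) (hg : ∀ x, g x ^ 2 = 1)
    (hS : fsum f g ^ 2 = (8 : ℝ) ^ n) (x : Fin n → Bool) :
    (2 : ℝ) ^ n * W g x = fsum f g * f x := by
  have hW : ∑ x, W g x ^ 2 = (4 : ℝ) ^ n := by
    rw [sum_W_sq]
    simp_rw [hg, sum_const, card_univ, Fintype.card_fun, Fintype.card_bool, Fintype.card_fin,
      nsmul_eq_mul, mul_one]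
    push_cast
    rw [← mul_pow]
    norm_num
  have hfW : ∑ x, f x * W g x = fsum f g := (fsum_eq_sum_mul_W f g).symm
  have hff : ∑ x : Fin n → Bool, f x ^ 2 = (2 : ℝ) ^ n := by
    simp_rw [hf, sum_const, card_univ, Fintype.card_fun, Fintype.card_bool, Fintype.card_fin,
      nsmul_eq_mul, mul_one]
    push_cast
    rfl
  have h48 : (4 : ℝ) ^ n * 4 ^ n = 2 ^ n * 8 ^ n := by
    rw [← mul_pow, ← mul_pow]; norm_num
  have htot : ∑ x, ((2 : ℝ) ^ n * W g x - fsum f g * f x) ^ 2 = 0 := by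
    have e : ∀ x : Fin n → Bool, ((2 : ℝ) ^ n * W g x - fsum f g * f x) ^ 2 =
        (4 : ℝ) ^ n * W g x ^ 2 - 2 * 2 ^ n * fsum f g * (f x * W g x) + fsum f g ^ 2 * f x ^ 2 := by
      intro x
      have h4 : (4 : ℝ) ^ n = 2 ^ n * 2 ^ n := by rw [← mul_pow]; norm_num
      rw [h4]
      ring
    simp_rw [e, sum_add_distrib, sum_sub_distrib, ← mul_sum, hW, hfW, hff, hS]
    linear_combination h48 - 2 * 2 ^ n * hS
  have hx := (sum_eq_zero_iff_of_nonneg fun x _ => sq_nonneg _).1 htot x (mem_univ _)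
  have : (2 : ℝ) ^ n * W g x - fsum f g * f x = 0 := pow_eq_zero_iff (n := 2) (by norm_num) |>.1 hx
  linarith

/-! ### Sign transport -/

/-- **SIGN TRANSPORT** (★, real form). For `±1`-valued `f, g` with `S(f,g)² = 8ⁿ`, every subspace
`U` and every shift `r`:
`2ⁿ · |U| · ∑_{y ∈ r + U^⊥} g(y) = S(f,g) · ∑_{x ∈ U} (-1)^{x·r} f(x)`.
The sign of `S(f,g)` (= the sign of `Φ`) is therefore the product of the signs of the two restricted
sums, for ANY `U` and any `r` making them non-zero. [folklore] -/
theorem sign_transport (f g : (Fin n → Bool) → ℝ) (hf : ∀ x, f x ^ 2 = 1) (hg : ∀ x, g x ^ 2 = 1)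
    (hS : fsum f g ^ 2 = (8 : ℝ) ^ n) {U : Finset (Fin n → Bool)} (hU : IsSubspace U)
    (r : Fin n → Bool) :
    (2 : ℝ) ^ n * U.card * ∑ y ∈ univ.filter (fun y => bxor r y ∈ perp U), g y =
      fsum f g * ∑ x ∈ U, twist x r * f x := by
  rw [mul_assoc, card_mul_sum_coset hU g r, mul_sum, mul_sum]
  refine sum_congr rfl fun x _ => ?_
  have hx := two_pow_mul_W_eq f g hf hg hS x
  calc (2 : ℝ) ^ n * (twist x r * W g x) = twist x r * ((2 : ℝ) ^ n * W g x) := by ring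
    _ = twist x r * (fsum f g * f x) := by rw [hx]
    _ = fsum f g * (twist x r * f x) := by ring

/-- **A good shift exists** (Parseval on `U`): for `±1`-valued `f` and non-empty `U` some `r` has
`∑_{x ∈ U} (-1)^{x·r} f(x) ≠ 0` (indeed `∑_r (…)² = 2ⁿ |U|`). For quadratic `f|_U` the set of good
`r` is an explicit affine subspace (Dickson), which is what the algorithm uses. [cite: ODonnell2014, §1.4] -/
theorem exists_twist_sum_ne_zero {U : Finset (Fin n → Bool)} (hU : U.Nonempty)
    (f : (Fin n → Bool) → ℝ) (hf : ∀ x, f x ^ 2 = 1) :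
    ∃ r : Fin n → Bool, ∑ x ∈ U, twist x r * f x ≠ 0 := by
  by_contra h
  push Not at h
  have hzero : ∑ r : Fin n → Bool, (∑ x ∈ U, twist x r * f x) ^ 2 = 0 := by
    simp [h]
  have hpos : ∑ r : Fin n → Bool, (∑ x ∈ U, twist x r * f x) ^ 2 = (2 : ℝ) ^ n * U.card := by
    have e1 : ∀ r : Fin n → Bool, (∑ x ∈ U, twist x r * f x) ^ 2 =
        ∑ x ∈ U, ∑ x' ∈ U, f x * f x' * twist (bxor x x') r := by
      intro r
      rw [sq, sum_mul_sum]
      refine sum_congr rfl fun x _ => sum_congr rfl fun x' _ => ?_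
      rw [twist_bxor_left]
      ring
    rw [sum_congr rfl fun r _ => e1 r, sum_comm]
    have e2 : ∀ x ∈ U, ∑ r, ∑ x' ∈ U, f x * f x' * twist (bxor x x') r = (2 : ℝ) ^ n * f x ^ 2 := by
      intro x hx
      rw [sum_comm]
      have e3 : ∀ x' ∈ U, ∑ r, f x * f x' * twist (bxor x x') r =
          f x * f x' * (if bxor x x' = zeroVec then (2 : ℝ) ^ n else 0) := by
        intro x' _
        rw [← mul_sum]
        congr 1
        exact sum_twist _
      rw [sum_congr rfl e3]
      simp_rw [bxor_eq_zeroVec_iff, mul_ite, mul_zero]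
      rw [Finset.sum_ite_eq U x, if_pos hx]
      ring
    rw [sum_congr rfl e2, ← mul_sum]
    simp_rw [hf, sum_const, nsmul_eq_mul, mul_one]
  rw [hzero] at hpos
  have hc : (0 : ℝ) < U.card := by exact_mod_cast hU.card_pos
  have : (0 : ℝ) < (2 : ℝ) ^ n * U.card := by positivity
  linarith

/-! ### Boolean data: the two signed cases `Φ = 1` and `Φ = -1` -/

theorem sqrt_two_pow_three_mul (n : ℕ) :
    Real.sqrt ((2 : ℝ) ^ (3 * n)) = (2 : ℝ) ^ n * Real.sqrt ((2 : ℝ) ^ n) := by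
  rw [show (2 : ℝ) ^ (3 * n) = ((2 : ℝ) ^ n) ^ 2 * (2 : ℝ) ^ n by ring,
    Real.sqrt_mul (by positivity), Real.sqrt_sq (by positivity)]

/-- `S(f,g) = √(2^{3n}) · Φ` for Boolean data read through `signOf`. [cite: AaronsonAmbainis2018, §1.1.1] -/
theorem fsum_signOf_eq (a b : (Fin n → Bool) → Bool) :
    fsum (fun x => signOf (a x)) (fun y => signOf (b y)) =
      Real.sqrt ((2 : ℝ) ^ (3 * n)) * forrelation a b := by
  rw [← phi_signOf, phi_eq_fsum, ← mul_assoc, mul_inv_cancel₀ (by positivity), one_mul]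

theorem fsum_signOf_sq_of_forrelation_sq (a b : (Fin n → Bool) → Bool) (h : forrelation a b ^ 2 = 1) :
    fsum (fun x => signOf (a x)) (fun y => signOf (b y)) ^ 2 = (8 : ℝ) ^ n := by
  rw [fsum_signOf_eq, mul_pow, h, mul_one, Real.sq_sqrt (by positivity), pow_mul]
  norm_num

/-- **(★) for a yes-instance of the signed exact slice** (`Φ(a,b) = 1`: `b` bent with dual `a`):
`|U| · ∑_{y ∈ r+U^⊥} (-1)^{b(y)} = 2^{n/2} · ∑_{x ∈ U} (-1)^{a(x) + x·r}` for every subspace `U`, every `r`.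
[cite: AaronsonAmbainis2018, §1.1.1] -/
theorem coset_sum_eq_of_forrelation_eq_one {a b : (Fin n → Bool) → Bool} (h : forrelation a b = 1)
    {U : Finset (Fin n → Bool)} (hU : IsSubspace U) (r : Fin n → Bool) :
    (U.card : ℝ) * ∑ y ∈ univ.filter (fun y => bxor r y ∈ perp U), signOf (b y) =
      Real.sqrt ((2 : ℝ) ^ n) * ∑ x ∈ U, twist x r * signOf (a x) := by
  have key := sign_transport (fun x => signOf (a x)) (fun y => signOf (b y))
    (fun x => signOf_sq (a x)) (fun y => signOf_sq (b y))
    (fsum_signOf_sq_of_forrelation_sq a b (by rw [h]; norm_num)) hU r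
  rw [fsum_signOf_eq, h, mul_one, sqrt_two_pow_three_mul, mul_assoc, mul_assoc] at key
  have h2 : (0 : ℝ) < (2 : ℝ) ^ n := by positivity
  have := mul_left_cancel₀ h2.ne' key
  simpa [mul_assoc] using this

/-- **(★) for a no-instance** (`Φ(a,b) = -1`: `b` bent with dual `¬a`): the same identity with a
minus sign. Together with the previous theorem: the crux bit is `sgn(∑_{r+U^⊥}(-1)^b)·sgn(∑_U(-1)^{a+r·x})`
for ANY subspace `U` and any `r` making the sums non-zero. [cite: AaronsonAmbainis2018, §1.1.1] -/
theorem coset_sum_eq_of_forrelation_eq_neg_one {a b : (Fin n → Bool) → Bool}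
    (h : forrelation a b = -1) {U : Finset (Fin n → Bool)} (hU : IsSubspace U) (r : Fin n → Bool) :
    (U.card : ℝ) * ∑ y ∈ univ.filter (fun y => bxor r y ∈ perp U), signOf (b y) =
      -(Real.sqrt ((2 : ℝ) ^ n) * ∑ x ∈ U, twist x r * signOf (a x)) := by
  have key := sign_transport (fun x => signOf (a x)) (fun y => signOf (b y))
    (fun x => signOf_sq (a x)) (fun y => signOf_sq (b y))
    (fsum_signOf_sq_of_forrelation_sq a b (by rw [h]; norm_num)) hU r
  rw [fsum_signOf_eq, h, mul_neg_one, sqrt_two_pow_three_mul, neg_mul, mul_assoc, mul_assoc,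
    ← mul_neg] at key
  have h2 : (0 : ℝ) < (2 : ℝ) ^ n := by positivity
  have := mul_left_cancel₀ h2.ne' key
  simpa [mul_assoc] using this

/-- **Sign rule, yes side**: on `Φ = 1` pairs the two restricted sums have the SAME sign (product `≥ 0`,
and `> 0` as soon as the `a`-side sum is non-zero). [cite: AaronsonAmbainis2018, §1.1.1] -/
theorem sign_rule_yes {a b : (Fin n → Bool) → Bool} (h : forrelation a b = 1)
    {U : Finset (Fin n → Bool)} (hU : IsSubspace U) (r : Fin n → Bool)
    (hr : ∑ x ∈ U, twist x r * signOf (a x) ≠ 0) :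
    0 < (∑ y ∈ univ.filter (fun y => bxor r y ∈ perp U), signOf (b y)) *
      ∑ x ∈ U, twist x r * signOf (a x) := by
  have key := coset_sum_eq_of_forrelation_eq_one h hU r
  have hcard : (0 : ℝ) < U.card := by exact_mod_cast card_pos.2 ⟨_, hU.1⟩
  have hs : (0 : ℝ) < Real.sqrt ((2 : ℝ) ^ n) := Real.sqrt_pos.2 (by positivity)
  have hsq : 0 < (∑ x ∈ U, twist x r * signOf (a x)) ^ 2 := by positivity
  -- multiply the claim by |U| > 0
  have : (U.card : ℝ) * ((∑ y ∈ univ.filter (fun y => bxor r y ∈ perp U), signOf (b y)) *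
      ∑ x ∈ U, twist x r * signOf (a x)) =
      Real.sqrt ((2 : ℝ) ^ n) * (∑ x ∈ U, twist x r * signOf (a x)) ^ 2 := by
    rw [← mul_assoc, key]; ring
  have hprod : 0 < (U.card : ℝ) * ((∑ y ∈ univ.filter (fun y => bxor r y ∈ perp U), signOf (b y)) *
      ∑ x ∈ U, twist x r * signOf (a x)) := by rw [this]; positivity
  exact pos_of_mul_pos_right hprod hcard.le

/-- **Sign rule, no side**: on `Φ = -1` pairs the two restricted sums have OPPOSITE signs.
[cite: AaronsonAmbainis2018, §1.1.1] -/
theorem sign_rule_no {a b : (Fin n → Bool) → Bool} (h : forrelation a b = -1)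
    {U : Finset (Fin n → Bool)} (hU : IsSubspace U) (r : Fin n → Bool)
    (hr : ∑ x ∈ U, twist x r * signOf (a x) ≠ 0) :
    (∑ y ∈ univ.filter (fun y => bxor r y ∈ perp U), signOf (b y)) *
      ∑ x ∈ U, twist x r * signOf (a x) < 0 := by
  have key := coset_sum_eq_of_forrelation_eq_neg_one h hU r
  have hcard : (0 : ℝ) < U.card := by exact_mod_cast card_pos.2 ⟨_, hU.1⟩
  have hs : (0 : ℝ) < Real.sqrt ((2 : ℝ) ^ n) := Real.sqrt_pos.2 (by positivity)
  have hsq : 0 < (∑ x ∈ U, twist x r * signOf (a x)) ^ 2 := by positivity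
  have : (U.card : ℝ) * ((∑ y ∈ univ.filter (fun y => bxor r y ∈ perp U), signOf (b y)) *
      ∑ x ∈ U, twist x r * signOf (a x)) =
      -(Real.sqrt ((2 : ℝ) ^ n) * (∑ x ∈ U, twist x r * signOf (a x)) ^ 2) := by
    rw [← mul_assoc, key]; ring
  have hprod : (U.card : ℝ) * ((∑ y ∈ univ.filter (fun y => bxor r y ∈ perp U), signOf (b y)) *
      ∑ x ∈ U, twist x r * signOf (a x)) < 0 := by
    rw [this, neg_lt_zero]; positivity
  by_contra hge
  push Not at hge
  have := mul_nonneg hcard.le hge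
  linarith

/-! ### The exact signed slice: instances -/

/-- On a two-circuit instance with `I.value = 1` the coset identity (★) holds between the two computed
functions: every restricted sum of `(-1)^{C₁}` over a coset of `U^⊥` is `2^{n/2}/|U|` times the twisted
restricted sum of `(-1)^{C₀}` over `U`. [cite: AaronsonAmbainis2018, §1.1.1] -/
theorem instance_coset_sum_of_value_eq_one {I : KForrelationInstance} (hk : I.k = 2) (hv : I.value = 1)
    {U : Finset (Fin I.n → Bool)} (hU : IsSubspace U) (r : Fin I.n → Bool) :
    (U.card : ℝ) * ∑ y ∈ univ.filter (fun y => bxor r y ∈ perp U),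
        signOf ((I.C (Fin.cast hk.symm 1)).eval y) =
      Real.sqrt ((2 : ℝ) ^ I.n) *
        ∑ x ∈ U, twist x r * signOf ((I.C (Fin.cast hk.symm 0)).eval x) := by
  refine coset_sum_eq_of_forrelation_eq_one ?_ hU r
  rw [← KForrelationInstance.value_eq_forrelation hk, hv]

/-- … and with the opposite sign on an instance with `I.value = -1`. [cite: AaronsonAmbainis2018, §1.1.1] -/
theorem instance_coset_sum_of_value_eq_neg_one {I : KForrelationInstance} (hk : I.k = 2)
    (hv : I.value = -1) {U : Finset (Fin I.n → Bool)} (hU : IsSubspace U) (r : Fin I.n → Bool) :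
    (U.card : ℝ) * ∑ y ∈ univ.filter (fun y => bxor r y ∈ perp U),
        signOf ((I.C (Fin.cast hk.symm 1)).eval y) =
      -(Real.sqrt ((2 : ℝ) ^ I.n) *
        ∑ x ∈ U, twist x r * signOf ((I.C (Fin.cast hk.symm 0)).eval x)) := by
  refine coset_sum_eq_of_forrelation_eq_neg_one ?_ hU r
  rw [← KForrelationInstance.value_eq_forrelation hk, hv]

/-! ### M-subspace duality: an M-subspace of `b` makes the dual affine on the dual cosets

If `b` is affine on every coset of a subspace `V` with `|V|² = 2ⁿ` (an **M-subspace**, Dillon's criterion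
for the completed Maiorana–McFarland class [cite: Carlet2020, Prop. 54]) and `Φ(a,b) = ±1`, then `a` is
affine on every coset of `V^⊥` — for ALL exact pairs, not only for MM templates (there it is McFarland's
dual formula [cite: Carlet2020, Prop. 77]). So (M-subspace of `b`) ⇒ (bi-affine, in particular
bi-isotropic, pair `(V, V^⊥)`) ⇒ sign by (★) from sums of AFFINE functions: the sign read-off of the
M-subspace attacks (this seat's `biiso.py`, the r-attack seat's `msub_attack.py`) is thereby certified for
every instance on which an M-subspace is found, however it is found. -/

/-- A `±1`-valued multiplicative character of a subspace sums to `|V|` or to `0`. [folklore] -/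
theorem sum_char_subspace {V : Finset (Fin n → Bool)} (hV : IsSubspace V) (χ : (Fin n → Bool) → ℝ)
    (hsq : ∀ v ∈ V, χ v = 1 ∨ χ v = -1) (hmul : ∀ u ∈ V, ∀ v ∈ V, χ (bxor u v) = χ u * χ v) :
    ∑ v ∈ V, χ v = V.card ∨ ∑ v ∈ V, χ v = 0 := by
  by_cases hall : ∀ v ∈ V, χ v = 1
  · left
    rw [sum_congr rfl hall, sum_const, nsmul_eq_mul, mul_one]
  · right
    push Not at hall
    obtain ⟨u₀, hu₀, hne⟩ := hall
    have hneg : χ u₀ = -1 := (hsq u₀ hu₀).resolve_left hne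
    have key : ∑ v ∈ V, χ (bxor u₀ v) = ∑ v ∈ V, χ v :=
      Finset.sum_nbij' (fun v => bxor u₀ v) (fun v => bxor u₀ v)
        (fun a ha => hV.2 u₀ hu₀ a ha) (fun a ha => hV.2 u₀ hu₀ a ha)
        (fun a _ => bxor_bxor_cancel_left u₀ a) (fun a _ => bxor_bxor_cancel_left u₀ a)
        (fun a _ => rfl)
    have h2 : ∑ v ∈ V, χ (bxor u₀ v) = χ u₀ * ∑ v ∈ V, χ v := by
      rw [mul_sum]
      exact sum_congr rfl fun v hv => hmul u₀ hu₀ v hv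
    have h3 := key.symm.trans h2
    rw [hneg] at h3
    linarith

/-- `|U| · |U^⊥| = 2ⁿ` for a subspace `U`. [folklore] -/
theorem card_mul_card_perp {U : Finset (Fin n → Bool)} (hU : IsSubspace U) :
    (U.card : ℝ) * (perp U).card = (2 : ℝ) ^ n := by
  have h1 : ∑ x : Fin n → Bool, ∑ u ∈ U, twist u x = (U.card : ℝ) * (perp U).card := by
    simp_rw [sum_twist_subspace hU]
    rw [Finset.sum_ite_mem, Finset.univ_inter, sum_const, nsmul_eq_mul, mul_comm]
  have h2 : ∑ x : Fin n → Bool, ∑ u ∈ U, twist u x = (2 : ℝ) ^ n := by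
    rw [sum_comm]
    have : ∀ u ∈ U, ∑ x : Fin n → Bool, twist u x = if u = zeroVec then (2 : ℝ) ^ n else 0 :=
      fun u _ => sum_twist u
    rw [sum_congr rfl this, sum_ite_eq' U zeroVec, if_pos hU.1]
  rw [← h1, h2]

/-- The orthogonal of a subspace is a subspace. [folklore] -/
theorem isSubspace_perp (U : Finset (Fin n → Bool)) : IsSubspace (perp U) := by
  refine ⟨mem_perp.2 fun x _ => twist_zeroVec_right x, fun x hx y hy => mem_perp.2 fun u hu => ?_⟩
  rw [twist_bxor_right, mem_perp.1 hx u hu, mem_perp.1 hy u hu, one_mul]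

/-- `V ⊆ V^⊥⊥`. [folklore] -/
theorem subset_perp_perp (V : Finset (Fin n → Bool)) : V ⊆ perp (perp V) := by
  intro v hv
  refine mem_perp.2 fun x hx => ?_
  rw [twist_comm]
  exact mem_perp.1 hx v hv

/-- For a half-dimensional subspace (`|V|² = 2ⁿ`), `V^⊥⊥ = V` and `|V^⊥| = |V|`. [folklore] -/
theorem perp_perp_eq_of_sq {V : Finset (Fin n → Bool)} (hV : IsSubspace V)
    (hcard : (V.card : ℝ) ^ 2 = (2 : ℝ) ^ n) :
    perp (perp V) = V ∧ ((perp V).card : ℝ) = V.card := by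
  have hVpos : (0 : ℝ) < V.card := by exact_mod_cast card_pos.2 ⟨_, hV.1⟩
  have hp : ((perp V).card : ℝ) = V.card := by
    have := card_mul_card_perp hV
    rw [← hcard, sq] at this
    exact mul_left_cancel₀ hVpos.ne' this
  have hpp : ((perp (perp V)).card : ℝ) = V.card := by
    have := card_mul_card_perp (isSubspace_perp V)
    rw [hp, ← hcard, sq] at this
    exact mul_left_cancel₀ hVpos.ne' this
  refine ⟨(eq_of_subset_of_card_le (subset_perp_perp V) ?_).symm, hp⟩
  exact_mod_cast hpp.le

/-- If `b` is affine on every coset of `V` (all second differences along `V` vanish) then every twisted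
coset sum `∑_{y ∈ r + V} (-1)^{b(y)} (-1)^{x₀·y}` is `0` or `± |V|`. [cite: Carlet2020, Prop. 54] -/
theorem coset_sum_of_affine_on_cosets {V : Finset (Fin n → Bool)} (hV : IsSubspace V)
    (b : (Fin n → Bool) → Bool)
    (hM : ∀ u ∈ V, ∀ v ∈ V, ∀ y, (b y ^^ b (bxor y u) ^^ b (bxor y v) ^^ b (bxor y (bxor u v))) = false)
    (r x₀ : Fin n → Bool) :
    let s := ∑ y ∈ univ.filter (fun y => bxor r y ∈ V), signOf (b y) * twist x₀ y
    s = V.card ∨ s = -V.card ∨ s = 0 := by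
  intro s
  -- reindex the coset by `y = r ⊕ v`, `v ∈ V`
  have hre : s = ∑ v ∈ V, signOf (b (bxor r v)) * twist x₀ (bxor r v) := by
    refine Finset.sum_nbij' (fun y => bxor r y) (fun v => bxor r v) ?_ ?_ ?_ ?_ ?_
    · intro y hy; exact (mem_filter.1 hy).2
    · intro v hv; exact mem_filter.2 ⟨mem_univ _, by rwa [bxor_bxor_cancel_left]⟩
    · intro y _; exact bxor_bxor_cancel_left r y
    · intro v _; exact bxor_bxor_cancel_left r v
    · intro y _; rw [bxor_bxor_cancel_left]
  -- the character `χ(v) = (-1)^{b(r⊕v) + b(r)} (-1)^{x₀·v}`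
  set χ : (Fin n → Bool) → ℝ := fun v => signOf (b (bxor r v)) * signOf (b r) * twist x₀ v with hχ
  have hterm : ∀ v ∈ V, signOf (b (bxor r v)) * twist x₀ (bxor r v) = signOf (b r) * twist x₀ r * χ v := by
    intro v _
    rw [hχ, twist_bxor_right]
    have := signOf_sq (b r)
    simp only
    linear_combination (-(signOf (b (bxor r v)) * twist x₀ r * twist x₀ v)) * this
  have hsq : ∀ v ∈ V, χ v = 1 ∨ χ v = -1 := by
    intro v _
    have h1 : χ v ^ 2 = 1 := by
      rw [hχ]; simp only
      rw [mul_pow, mul_pow, signOf_sq, signOf_sq, twist_sq]; norm_num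
    have h1' : χ v * χ v = 1 := by rw [← sq]; exact h1
    exact mul_self_eq_one_iff.1 h1'
  have hmul : ∀ u ∈ V, ∀ v ∈ V, χ (bxor u v) = χ u * χ v := by
    intro u hu v hv
    have h4 := hM u hu v hv r
    rw [hχ]; simp only
    rw [twist_bxor_right]
    rcases Bool.eq_false_or_eq_true (b r) with e1 | e1 <;>
      rcases Bool.eq_false_or_eq_true (b (bxor r u)) with e2 | e2 <;>
        rcases Bool.eq_false_or_eq_true (b (bxor r v)) with e3 | e3 <;>
          rcases Bool.eq_false_or_eq_true (b (bxor r (bxor u v))) with e4 | e4 <;>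
            simp only [e1, e2, e3, e4] at h4 ⊢ <;> simp [signOf] at h4 ⊢
  have hsum : ∑ v ∈ V, signOf (b (bxor r v)) * twist x₀ (bxor r v) =
      signOf (b r) * twist x₀ r * ∑ v ∈ V, χ v := by
    rw [mul_sum]; exact sum_congr rfl hterm
  rw [hre, hsum]
  have hc : signOf (b r) * twist x₀ r = 1 ∨ signOf (b r) * twist x₀ r = -1 := by
    rcases twist_eq_one_or x₀ r with h | h <;>
      rcases Bool.eq_false_or_eq_true (b r) with h' | h' <;> simp [signOf, h, h']
  rcases sum_char_subspace hV χ hsq hmul with h | h <;> rcases hc with h' | h' <;> rw [h, h'] <;> norm_num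

/-- A sum of `±1` terms over a finset equal to `± card` forces all terms to be equal to that sign. [folklore] -/
theorem all_eq_of_sum_eq_card {ι : Type*} [DecidableEq ι] (s : Finset ι) (f : ι → ℝ) (hf : ∀ i ∈ s, f i = 1 ∨ f i = -1)
    (c : ℝ) (hc : c = 1 ∨ c = -1) (hsum : ∑ i ∈ s, f i = c * s.card) : ∀ i ∈ s, f i = c := by
  intro i hi
  by_contra hne
  -- f i = -c; then the sum is at most c·card - 2 in the direction of c
  have hfi : f i = -c := by
    rcases hf i hi with h | h <;> rcases hc with h' | h' <;> simp_all
  have key : ∑ j ∈ s, c * f j ≤ (s.card : ℝ) - 2 := by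
    have hle : ∀ j ∈ s, c * f j ≤ 1 := by
      intro j hj
      rcases hf j hj with h | h <;> rcases hc with h' | h' <;> rw [h, h'] <;> norm_num
    have hsplit := Finset.add_sum_erase s (fun j => c * f j) hi
    have hrest : ∑ j ∈ s.erase i, c * f j ≤ ((s.erase i).card : ℝ) := by
      have h' : ∑ j ∈ s.erase i, c * f j ≤ ∑ j ∈ s.erase i, (1 : ℝ) :=
        Finset.sum_le_sum fun j hj => hle j (Finset.mem_of_mem_erase hj)
      rwa [sum_const, nsmul_eq_mul, mul_one] at h'
    rw [Finset.card_erase_of_mem hi] at hrest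
    have hci : c * f i = -1 := by
      rw [hfi]; rcases hc with h' | h' <;> rw [h'] <;> norm_num
    have hcard1 : (1 : ℕ) ≤ s.card := card_pos.2 ⟨i, hi⟩
    rw [← hsplit, hci]
    push_cast [Nat.cast_sub hcard1] at hrest ⊢
    linarith
  have hsum' : ∑ j ∈ s, c * f j = s.card := by
    rw [← mul_sum, hsum, ← mul_assoc]
    rcases hc with h' | h' <;> rw [h'] <;> norm_num
  linarith

/-- **M-subspace duality for exact pairs.** Let `V` be a subspace with `|V|² = 2ⁿ` on whose cosets `b` is
affine (all second differences of `b` along `V` vanish — an M-subspace), and let `Φ(a,b) = ±1`. Then `a`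
is affine on every coset `x₀ + V^⊥`: some `r` has `(-1)^{a(x₀ ⊕ x)} (-1)^{x·r} = (-1)^{a(x₀)}` for all
`x ∈ V^⊥`. (For MM templates this is McFarland's dual formula; here for all exact pairs, via (★) applied to
the re-randomised pair `(a(x₀ ⊕ ·), (-1)^{b} (-1)^{x₀·}`).) [cite: Carlet2020, Prop. 77] -/
theorem dual_affine_on_perp_cosets {a b : (Fin n → Bool) → Bool}
    (hΦ : forrelation a b = 1 ∨ forrelation a b = -1) {V : Finset (Fin n → Bool)} (hV : IsSubspace V)
    (hcard : (V.card : ℝ) ^ 2 = (2 : ℝ) ^ n)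
    (hM : ∀ u ∈ V, ∀ v ∈ V, ∀ y, (b y ^^ b (bxor y u) ^^ b (bxor y v) ^^ b (bxor y (bxor u v))) = false)
    (x₀ : Fin n → Bool) :
    ∃ r : Fin n → Bool, ∀ x ∈ perp V, signOf (a (bxor x₀ x)) * twist x r = signOf (a x₀) := by
  -- the re-randomised real pair
  set f : (Fin n → Bool) → ℝ := fun x => signOf (a (bxor x₀ x)) with hf
  set g : (Fin n → Bool) → ℝ := fun y => signOf (b y) * twist x₀ y with hg
  have hf1 : ∀ x, f x ^ 2 = 1 := fun x => signOf_sq _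
  have hg1 : ∀ y, g y ^ 2 = 1 := fun y => by rw [hg]; simp only; rw [mul_pow, signOf_sq, twist_sq, one_mul]
  -- `fsum f g = fsum (signOf∘a) (signOf∘b)` by reindexing `x ↦ x₀ ⊕ x`
  have hfsum : fsum f g = fsum (fun x => signOf (a x)) (fun y => signOf (b y)) := by
    rw [fsum, fsum]
    rw [← Equiv.sum_comp (bxorPerm x₀) (fun x => ∑ y, signOf (a x) * twist x y * signOf (b y))]
    refine sum_congr rfl fun x _ => sum_congr rfl fun y _ => ?_
    rw [hf, hg, bxorPerm_apply]
    simp only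
    rw [twist_bxor_left]
    ring
  have hS : fsum f g ^ 2 = (8 : ℝ) ^ n := by
    rw [hfsum]
    refine fsum_signOf_sq_of_forrelation_sq a b ?_
    rcases hΦ with h | h <;> rw [h] <;> norm_num
  -- (★) for (f, g) at U = V^⊥, whose orthogonal is V
  obtain ⟨hpp, hcardp⟩ := perp_perp_eq_of_sq hV hcard
  have hU : IsSubspace (perp V) := isSubspace_perp V
  obtain ⟨r, hr⟩ := exists_twist_sum_ne_zero (U := perp V) ⟨_, hU.1⟩ f hf1
  refine ⟨r, ?_⟩
  have key := sign_transport f g hf1 hg1 hS hU r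
  rw [hpp] at key
  -- the `g`-side coset sum is `0` or `±|V|`
  have hcos := coset_sum_of_affine_on_cosets hV b hM r x₀
  simp only at hcos
  have hgsum : ∑ y ∈ univ.filter (fun y => bxor r y ∈ V), g y =
      ∑ y ∈ univ.filter (fun y => bxor r y ∈ V), signOf (b y) * twist x₀ y := rfl
  -- `|fsum f g| = √(8ⁿ) = 2ⁿ · √(2ⁿ)/... ` ; we only need: the f-side sum is ±|V^⊥|
  have hVpos : (0 : ℝ) < V.card := by exact_mod_cast card_pos.2 ⟨_, hV.1⟩
  have hVn : (V.card : ℝ) = Real.sqrt ((2 : ℝ) ^ n) := by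
    rw [← hcard, Real.sqrt_sq hVpos.le]
  have hF : fsum f g = (2 : ℝ) ^ n * V.card ∨ fsum f g = -((2 : ℝ) ^ n * V.card) := by
    have h8 : ((2 : ℝ) ^ n * V.card) ^ 2 = (8 : ℝ) ^ n := by
      rw [mul_pow, hcard, ← pow_mul, ← pow_add, show n * 2 + n = 3 * n by ring, pow_mul]; norm_num
    have : (fsum f g - (2 : ℝ) ^ n * V.card) * (fsum f g + (2 : ℝ) ^ n * V.card) = 0 := by
      nlinarith [hS, h8]
    rcases mul_eq_zero.1 this with h | h
    · left; linarith
    · right; linarith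
  -- from key: 2ⁿ |V^⊥| (coset sum) = fsum · (f-sum); so f-sum ∈ {0, ±|V|}; it is ≠ 0, so all terms agree
  set Sa := ∑ x ∈ perp V, twist x r * f x with hSa
  have hSa_val : Sa = V.card ∨ Sa = -V.card := by
    rw [hcardp, hgsum] at key
    have h2n : (0 : ℝ) < (2 : ℝ) ^ n * V.card := by positivity
    rcases hcos with hc | hc | hc <;> rcases hF with hFv | hFv <;> rw [hc, hFv] at key
    · left; nlinarith [key, h2n]
    · right; nlinarith [key, h2n]
    · right; nlinarith [key, h2n]
    · left; nlinarith [key, h2n]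
    · exfalso; apply hr
      have : ((2 : ℝ) ^ n * V.card) * Sa = 0 := by rw [hSa]; nlinarith [key]
      exact (mul_eq_zero.1 this).resolve_left h2n.ne'
    · exfalso; apply hr
      have : ((2 : ℝ) ^ n * V.card) * Sa = 0 := by rw [hSa]; nlinarith [key]
      exact (mul_eq_zero.1 this).resolve_left h2n.ne'
  -- all terms `twist x r * f x` (`x ∈ V^⊥`) equal the common sign, which is the value at `x = 0`
  have hterms : ∀ x ∈ perp V, twist x r * f x = 1 ∨ twist x r * f x = -1 := by
    intro x _
    simp only [hf]
    rcases twist_eq_one_or x r with h | h <;>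
      rcases Bool.eq_false_or_eq_true (a (bxor x₀ x)) with h' | h' <;> simp [signOf, h, h']
  rcases hSa_val with h | h
  · have hall := all_eq_of_sum_eq_card (perp V) (fun x => twist x r * f x) hterms 1 (Or.inl rfl)
      (by rw [one_mul, hcardp]; exact h)
    have h0 := hall zeroVec hU.1
    simp only [hf, twist_comm zeroVec, twist_zeroVec_right, one_mul, bxor_zeroVec] at h0
    intro x hx
    have := hall x hx
    simp only [hf] at this
    rw [mul_comm] at this
    rw [this, h0]
  · have hall := all_eq_of_sum_eq_card (perp V) (fun x => twist x r * f x) hterms (-1) (Or.inr rfl)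
      (by rw [neg_one_mul, hcardp]; exact h)
    have h0 := hall zeroVec hU.1
    simp only [hf, twist_comm zeroVec, twist_zeroVec_right, one_mul, bxor_zeroVec] at h0
    intro x hx
    have := hall x hx
    simp only [hf] at this
    rw [mul_comm] at this
    rw [this, h0]

/-! ### NEAR-MISS (the only `sorry` of this file) -/

/-- NEAR-MISS — `¬ crux`. What a proof needs and where it stands (2026-08-16):
(1) a polynomial-time map `BI-ISO : (T_a, T_b) ↦ U` that is CORRECT ON EVERY exact cubic pair — open:
    the finders of `biiso.py` / `msub_attack.py` are linear-algebra heuristics with a sound certificate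
    (check bi-isotropy, then (★)); they solve every planted family tried (cube/APN blocks, Feistel
    involutions, LS-rich, mixed; n ≤ 64 here, n ≤ 96 in j007388) but uniform correctness over all
    quadratic permutations with quadratic inverse is unproved (MinRank/IP1S-type worst case), and for
    non-MM pairs (r5 open) even existence of `U` is unknown;
(2) the `FP`/`TM2` coding of: ANF interpolation of the two circuits on the `O(n³)` low-weight points,
    the linear algebra, two quadratic Gauss sums by variable elimination, and the wrapper
    `PromiseProblem.mem_PromiseBPP'_of_fp_decider` (deterministic, so `uniformProb` is trivial) — the
    same plumbing debt that keeps crux 2204 (unsigned rung, true on paper) open.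
Tried this cycle: (★) proved (above); kit experiments (NOTES.md); no counterexample family to the
finder found, hence no reason to believe S, but no worst-case theorem either. -/
theorem crux_false_sketch :
    ¬ Summit.QuantumAdvantage.QuantumAdvantage.Theses.CubicForrelation.SignedExactCubicForrelationNotPrBPP := by
  sorry

end Summit.QuantumAdvantage.QuantumAdvantage.Cruxes.SignedExactCubicForrelationNotPrBPP.Disproof

end
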